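import Summits.BirchSwinnertonDyer.BirchSwinnertonDyer.Theorems.PrintCf2RamifiedOffTYZRankZeroDigitInvisible
import Summits.BirchSwinnertonDyer.Rank1Residual.P2.CongruentNumberPairsAtTwoThreeFiveFamily
import Literature.NumberTheory.EllipticCurves.Smith2016.CongruentNumberGenusDeterminantRowsTwoThreeConsequences
import Literature.NumberTheory.EllipticCurves.CongruentNumberMonskySelmerParityAnalytic
import Literature.NumberTheory.EllipticCurves.TianYuanZhang2017.RhoIndexMonskyKernelOdd
import HarnessLib

/-!
# The PRIME-BLOCK DIGITS of Tian–Yuan–Zhang's recursion, BY NAME inside 𝔅_ram — and the two-prime interface of C⁺ with its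
# parity hypotheses DISCHARGED (crux stmt-BirchSwinnertonDyer-20509 `RamifiedOffTYZOfFacts`, line `offtyz-v7`, LEAD g26, cycle 27)

HONEST FRAMING (cell `bsd-print-cf2`, route `PrintCf2`; `--supports stmt-BirchSwinnertonDyer-20509`; theorems only, `def`-free, no
`sorry`).  BSD is not proved by any of this; no class is closed by this file; item 23431 (C⁺) and crux 20509 stay OPEN.

The two-prime theorems of the line (g10 `…LevelTwoTwoPrimes`, g25 `…RankZeroDigitDepthTwo` / `…RankZeroDigitInvisible`) carry, besides the
named facts and the display package, PARITY hypotheses on the prime blocks of `n = l·m` (`l ≡ 1`, `m ≡ 5, 7 (mod 8)`): `𝓛(l) = 2c′`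
(resp. `2 ∣ 𝓛(l)` only under `ord_{s=1} L(E_l, s) = 0`) and `𝓛(m)` odd.  THIS FILE proves them BY NAME — every `k = 1` digit the
recursion consumes is a theorem of the bundle 𝔅_ram of crux 20509 (indeed of its conjuncts 2, 4, 5 alone):

* §1 (rank-ONE side, conjunct 5 = TYZ Thm 1.2′ only) — for every prime `q ≡ 5, 7 (mod 8)`: **`𝓛(q)` is ODD** for every sign choice
  (`odd_of_isScriptL_prime`) and **`ord_{s=1} L(E_q, s) = 1`** (`analyticRank_prime_eq_one`): `ρ(q) = 0` (tree theorem
  `RhoMonskyKernel.rhoIndex_eq_one_of_odd_prime`), `Σ₁(q) = g(q)` odd (Rédei–Reichardt is a tree THEOREM: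
  `Smith2016.odd_genusClassNumber_genusField_prime_three_mod_four`, `P2.odd_genusClassNumber_genusField_prime_five_mod_eight` with
  `redeiReichardt_fourTwoCard_classGroup_holds`), TYZ Thm 1.2′ at `ρ = 0`; at PACKAGE level (`D : GenusPointData n`, `q ∣ n`, integrality
  display `scriptLSpec`): `Odd (D.scriptL q)` (`odd_scriptL_prime`).
* §2 (rank-ZERO side, conjuncts 2, 4 = modularity, CM rank-zero BSD) — for every prime `l ≡ 1 (mod 8)`: `ord_{s=1} L(E_l, s) ≠ 1`
  (UNCONDITIONAL: Koblitz's CM functional equation, tree theorem `MonskySelmerParity.even_analyticRank_congruentNumberCurve_iff`), hence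
  **`2 ∣ 𝓛(l)` with NO analytic-rank hypothesis** (`two_dvd_of_isScriptL_prime_one`: rank `0` by g25's digit, rank `≥ 2` by `𝓛(l) = 0`), and the
  complete `k = 1` digit **`4 ∣ 𝓛(l) ⟺ ord_{s=1} L(E_l,s) ≥ 2 ∨ #Sel₄(E_l) ≠ 2⁴`** (`four_dvd_isScriptL_prime_one_iff`).
* §3 — the two-prime interface with these digits SUPPLIED: layer one `P(lm) ∈ 2A + tors ⟺ Z(lm) ∈ 2A + tors`
  (`twoDivisible_genusPoint_iff_genusPeriod_of_facts`), the depth-two trichotomy (`fourDivisible_genusPoint_trichotomy_of_facts`), and ★★★ the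
  invisible-R2 headline of g25 with `hLq` AND `h0` REMOVED (`levelTwo_iff_genusPeriod_depth_of_facts`): granted conjuncts 1, 2, 4, 5 of 𝔅_ram,
  for primes `l ≡ 1`, `q ≡ 7 (mod 8)`, `n = lq` with `ord_{s=1} L(E_n, s) = 1`, display package `D` (`Printed` + CM-point layer), `ρ(n) = 0`,
  invisible generator `(2s², Y)`, and Thm 3.5 at `q` read in `ℍ′_n` (`h35q`, the ONE remaining display-shaped hypothesis):
  **C⁺ at `lq` ⟺ `Z(lq) ∈ 2A + tors ∧ Z(lq) ∉ 4A + tors`** UNLESS the digit `δ(l) := [ord_{s=1} L(E_l,s) = 0 ∧ #Sel₄(E_l) = 2⁴]` is on, in which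
  case **C⁺ at `lq` ⟺ `Z(lq) ∈ 2A + tors ∧ Z(lq) − α_q ∉ 4A + tors`**; §4 the same with 𝔅_ram VERBATIM as hypothesis (`…_of_bundle`).

So on the two-prime sectors every hypothesis of the line's C⁺-readings is now a named fact of 𝔅_ram, a display of [TianYuanZhang2017] §3, or
one of the structural bits of the row (`ρ(n)`, the generator's descent class, `h35q`).  What stays OPEN is unchanged and isolated: the depth-two
class of the genus period `Z(lq)` (CM values of level-32 modular units; no print).

References: [cite: TianYuanZhang2017, Thm. 1.1, Thm. 1.2 (p0002 L101–L127), §3.1 (p0011 L53–L73), Thm. 3.5 (p0011 L94–L100)];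
[cite: KoblitzECMF1993, Ch. II §5, Theorem (p. 84)]; [cite: LiMa2008, Thm. 0.4 with Lemma 0.1]; [cite: BurungaleFlach2024, Thm 1.1 / Cor. 3];
[cite: HeathBrown1994SelmerCongruentII, Appendix (Monsky)]; [cite: Darmon2004, Thm. 3.22]; tree: `…RankZeroDigit{,DepthTwo,Invisible}` (g25),
`…LevelTwoTwoPrimes` (g10), `…InvisibleGenerator` (g18), `Rank1Residual/P2/CongruentNumberPairsAtTwo{PrimeSevenModEight,ThreeFiveFamily}`.
-/

noncomputable section

open scoped Classical

open WeierstrassCurve WeierstrassCurve.Affine WeierstrassCurve.Affine.Point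
  Literature.NumberTheory.EllipticCurves Literature.NumberTheory.EllipticCurves.Rank1Residual
  Summit.BirchSwinnertonDyer.Rank1Residual
  Literature.NumberTheory.EllipticCurves.TianYuanZhang2017
  Literature.NumberTheory.EllipticCurves.TianYuanZhang2017.W2
  Literature.NumberTheory.QuadraticFields.RedeiReichardt
  Summit.BirchSwinnertonDyer.PrintCf2.LevelTwoTwoPrimes
  Summit.BirchSwinnertonDyer.PrintCf2.RankZeroDigitDepthTwo

set_option autoImplicit false

namespace Summit.BirchSwinnertonDyer.PrintCf2.PrimeBlockDigits

/-! ## §1 The rank-ONE prime blocks `q ≡ 5, 7 (mod 8)`: `𝓛(q)` odd, `ord_{s=1} L(E_q, s) = 1` — conjunct 5 of 𝔅_ram alone -/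

section RankOnePrime

/-- `Σ₁(q) = g(q) = #2Cl(ℚ(√−q))` is odd for a prime `q ≡ 5, 7 (mod 8)` — Rédei–Reichardt at `t ≤ 2` (tree theorems; the displayed fact
`redeiReichardt_fourTwoCard_classGroup` is PROVED in the tree). [cite: LiMa2008, Thm. 0.4 with Lemma 0.1] [cite: TianYuanZhang2017, Thm. 1.2 (Σ₁)] -/
theorem odd_genusSum₁_prime {q : ℕ} (hq : q.Prime) (hq8 : q % 8 = 5 ∨ q % 8 = 7) :
    Odd (genusSum₁ q fun d => genusClassNumber (GenusField d)) := by
  rw [P2.genusSum₁_prime hq]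
  rcases hq8 with h5 | h7
  · exact P2.odd_genusClassNumber_genusField_prime_five_mod_eight redeiReichardt_fourTwoCard_classGroup_holds hq h5
  · exact Smith2016.odd_genusClassNumber_genusField_prime_three_mod_four hq (by omega)

/-- **For a prime `q ≡ 5, 7 (mod 8)`, `𝓛(q)` is an ODD integer** (some sign choice), granted TYZ Thm 1.2′ (conjunct 5 of 𝔅_ram):
`ρ(q) = 0` (`RhoMonskyKernel.rhoIndex_eq_one_of_odd_prime`) and `Σ₁(q) = g(q)` is odd.
[cite: TianYuanZhang2017, Thm. 1.2 (p0002 L101–L120)] [cite: LiMa2008, Thm. 0.4] -/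
theorem exists_odd_isScriptL_prime (h12 : thm12_parity_of_scriptL') {q : ℕ} (hq : q.Prime) (hq8 : q % 8 = 5 ∨ q % 8 = 7) :
    ∃ L : ℤ, Odd L ∧ IsScriptL q L :=
  exists_odd_scriptL_of_index_eq_one' h12 hq.squarefree hq8 (RhoMonskyKernel.rhoIndex_eq_one_of_odd_prime hq (by omega))
    GenusField (isGenusFieldFamily_genusField q) (Or.inl (odd_genusSum₁_prime hq hq8))

/-- **Every sign choice of `𝓛(q)` is odd** for a prime `q ≡ 5, 7 (mod 8)` (granted conjunct 5): `𝓛(q)² = L²` pins `L` up to sign.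
[cite: TianYuanZhang2017, Thm. 1.2, §1 ("𝓛(n) is only well-defined up to a sign")] -/
theorem odd_of_isScriptL_prime (h12 : thm12_parity_of_scriptL') {q : ℕ} (hq : q.Prime) (hq8 : q % 8 = 5 ∨ q % 8 = 7)
    {L : ℤ} (hL : IsScriptL q L) : Odd L := by
  obtain ⟨L', hodd, hL'⟩ := exists_odd_isScriptL_prime h12 hq hq8
  rcases LevelTwo.eq_or_eq_neg_of_isScriptL hL hL' with rfl | rfl
  · exact hodd
  · exact hodd.neg

/-- **`ord_{s=1} L(E_q, s) = 1` for every prime `q ≡ 5, 7 (mod 8)`**, granted conjunct 5 of 𝔅_ram (TYZ's rank-one datum at `ρ = 0`).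
[cite: TianYuanZhang2017, Thm. 1.2 and §1 (1.1)] -/
theorem analyticRank_prime_eq_one (h12 : thm12_parity_of_scriptL') {q : ℕ} (hq : q.Prime) (hq8 : q % 8 = 5 ∨ q % 8 = 7) :
    (congruentNumberCurve q).analyticRank = 1 := by
  obtain ⟨-, -, hr, -⟩ := rankOneDatum_of_index_eq_one' h12 hq.squarefree hq8
    (RhoMonskyKernel.rhoIndex_eq_one_of_odd_prime hq (by omega)) GenusField (isGenusFieldFamily_genusField q)
    (Or.inl (odd_genusSum₁_prime hq hq8))
  exact hr

/-- **PACKAGE LEVEL: the data's sign choice `D.scriptL q` is odd** for every prime block `q ≡ 5, 7 (mod 8)` of `n` (`q ∣ n`), granted conjunct 5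
and the integrality display `scriptLSpec` (`𝓛(d) ∈ ℤ` for `1 < d ∣ n`). [cite: TianYuanZhang2017, §3.1 (p0011 L73), Thm. 1.2] -/
theorem odd_scriptL_prime (h12 : thm12_parity_of_scriptL') {n : ℕ} (D : GenusPointData n) (hLs : D.scriptLSpec) {q : ℕ} (hq : q.Prime)
    (hq8 : q % 8 = 5 ∨ q % 8 = 7) (hqn : q ∣ n) (hn : n ≠ 0) : Odd (D.scriptL q) :=
  odd_of_isScriptL_prime h12 hq hq8 (hLs q (Nat.mem_divisors.mpr ⟨hqn, hn⟩) hq.one_lt)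

/-- Package level on the two-prime sector `n = l·m`: `Odd (D.scriptL m)` for the prime block `m ≡ 5, 7 (mod 8)`.
[cite: TianYuanZhang2017, §3.1 (p0011 L73), Thm. 1.2] -/
theorem odd_scriptL_right (h12 : thm12_parity_of_scriptL') {n l m : ℕ} (hl : l.Prime) (hm : m.Prime) (hm8 : m % 8 = 5 ∨ m % 8 = 7)
    (hn : n = l * m) (D : GenusPointData n) (hLs : D.scriptLSpec) : Odd (D.scriptL m) :=
  odd_scriptL_prime h12 D hLs hm hm8 (hn ▸ Dvd.intro_left l rfl) (hn ▸ Nat.mul_ne_zero hl.ne_zero hm.ne_zero)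

end RankOnePrime

/-! ## §2 The rank-ZERO prime blocks `l ≡ 1 (mod 8)`: `2 ∣ 𝓛(l)` with no analytic-rank hypothesis — conjuncts 2, 4 of 𝔅_ram -/

section RankZeroPrime

/-- **`ord_{s=1} L(E_l, s) ≠ 1` for a prime `l ≡ 1 (mod 8)`**, UNCONDITIONALLY: the order is even by Koblitz's CM functional equation (sign
`χ₋₄(l)χ₈(l) = +1`; tree theorem `MonskySelmerParity.even_analyticRank_congruentNumberCurve_iff`). [cite: KoblitzECMF1993, Ch. II §5, Theorem (p. 84)] -/
theorem analyticRank_prime_one_ne_one {l : ℕ} (hl : l.Prime) (hl8 : l % 8 = 1) : (congruentNumberCurve l).analyticRank ≠ 1 := by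
  intro h1
  have heven := (MonskySelmerParity.even_analyticRank_congruentNumberCurve_iff hl.squarefree).mpr (Or.inl hl8)
  rw [h1] at heven
  exact Nat.not_even_one heven

/-- For a prime `l ≡ 1 (mod 8)`: `ord_{s=1} L(E_l, s) = 0` or `≥ 2`. [cite: KoblitzECMF1993, Ch. II §5, Theorem (p. 84)] -/
theorem analyticRank_prime_one_eq_zero_or_two_le {l : ℕ} (hl : l.Prime) (hl8 : l % 8 = 1) :
    (congruentNumberCurve l).analyticRank = 0 ∨ 2 ≤ (congruentNumberCurve l).analyticRank := by
  have h := analyticRank_prime_one_ne_one hl hl8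
  omega

/-- **`2 ∣ 𝓛(l)` for every prime `l ≡ 1 (mod 8)` and every sign choice, with NO analytic-rank hypothesis**, granted conjuncts 2 (modularity) and 4
(CM rank-zero BSD) of 𝔅_ram: in analytic rank `0` this is g25's digit (`#Ш(E_l) = 𝓛(l)²` with Monsky's `#Sel₂(E_l) = 2⁴`), in analytic rank `≥ 2`
`𝓛(l) = 0`, and rank `1` is excluded by parity. [cite: TianYuanZhang2017, §1 (1.1)] [cite: BurungaleFlach2024, Thm 1.1 / Cor. 3]
[cite: KoblitzECMF1993, Ch. II §5, Theorem (p. 84)] -/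
theorem two_dvd_of_isScriptL_prime_one (hmod : WeierstrassCurve.hasEntireLFunction_rat) (hCM0 : bsdTriple_of_hasCM_of_L_one_ne_zero)
    {l : ℕ} (hl : l.Prime) (hl8 : l % 8 = 1) {L : ℤ} (hL : IsScriptL l L) : (2 : ℤ) ∣ L := by
  rcases analyticRank_prime_one_eq_zero_or_two_le hl hl8 with h0 | h2
  · exact (RankZeroDigit.prime_one_mod_eight_digit_of_facts hmod hCM0 hl hl8 h0 hL).2.1
  · rw [RankZeroDigit.scriptL_eq_zero_of_two_le_analyticRank h2 hL]
    exact dvd_zero 2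

/-- ★ **THE COMPLETE `k = 1` DIGIT AT `l ≡ 1 (mod 8)`, inside 𝔅_ram (conjuncts 2, 4):** for every prime `l ≡ 1 (mod 8)` and every `L` with
`𝓛(l)² = L²`: **`4 ∣ L ⟺ ord_{s=1} L(E_l, s) ≥ 2 ∨ #Sel₄(E_l) ≠ 2⁴`** (`Ш(E_l)[4] ≠ Ш(E_l)[2]`).
[cite: TianYuanZhang2017, §1 (1.1)] [cite: BurungaleFlach2024, Thm 1.1 / Cor. 3] [cite: HeathBrown1994SelmerCongruentII, Appendix (Monsky)] -/
theorem four_dvd_isScriptL_prime_one_iff (hmod : WeierstrassCurve.hasEntireLFunction_rat) (hCM0 : bsdTriple_of_hasCM_of_L_one_ne_zero)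
    {l : ℕ} (hl : l.Prime) (hl8 : l % 8 = 1) {L : ℤ} (hL : IsScriptL l L) :
    (4 : ℤ) ∣ L ↔ 2 ≤ (congruentNumberCurve l).analyticRank ∨ Nat.card ((congruentNumberCurve l).selmerGroup 4) ≠ 2 ^ 4 := by
  rcases analyticRank_prime_one_eq_zero_or_two_le hl hl8 with h0 | h2
  · rw [(RankZeroDigit.prime_one_mod_eight_digit_of_facts hmod hCM0 hl hl8 h0 hL).2.2]
    constructor
    · exact Or.inr
    · rintro (h | h)
      · omega
      · exact h
  · rw [RankZeroDigit.scriptL_eq_zero_of_two_le_analyticRank h2 hL]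
    exact ⟨fun _ => Or.inl h2, fun _ => dvd_zero 4⟩

/-- Package level on the two-prime sector `n = l·m`: **`D.scriptL l = 2c′` for some `c′`** (the hypothesis `hLl` of g10's `…LevelTwoTwoPrimes`),
granted conjuncts 2, 4. [cite: TianYuanZhang2017, §3.1 (p0011 L73), §1 (1.1)] -/
theorem exists_scriptL_left_eq_two_mul (hmod : WeierstrassCurve.hasEntireLFunction_rat) (hCM0 : bsdTriple_of_hasCM_of_L_one_ne_zero)
    {n l m : ℕ} (hl : l.Prime) (hm : m.Prime) (hl8 : l % 8 = 1) (hn : n = l * m) (D : GenusPointData n) (hLs : D.scriptLSpec) :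
    ∃ c' : ℤ, D.scriptL l = 2 * c' :=
  two_dvd_of_isScriptL_prime_one hmod hCM0 hl hl8 (isScriptL_scriptL_left hl hm hn D hLs)

end RankZeroPrime

/-! ## §3 The two-prime interface of C⁺ with the prime-block digits supplied -/

section TwoPrimes

variable {n : ℕ}

/-- **Layer one on the two-prime sector, parity hypotheses discharged**: granted conjuncts 2, 4, 5 of 𝔅_ram, for primes `l ≡ 1`, `m ≡ 5, 7 (mod 8)`,
`n = lm`, data with the displayed recursion, `ε`-types and integrality, and Thm 3.5 at `m` read in `ℍ′_n` (`u = ±1`):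
`P(lm) ∈ 2A + tors ⟺ Z(lm) ∈ 2A + tors`. [cite: TianYuanZhang2017, §3.1 (p0011 L67–L73), Thm. 3.5 (p0011 L94–L100), Thm. 1.2] -/
theorem twoDivisible_genusPoint_iff_genusPeriod_of_facts (hmod : WeierstrassCurve.hasEntireLFunction_rat)
    (hCM0 : bsdTriple_of_hasCM_of_L_one_ne_zero) (h12 : thm12_parity_of_scriptL')
    {l m : ℕ} (hl : l.Prime) (hm : m.Prime) (hl8 : l % 8 = 1) (hm8 : m % 8 = 5 ∨ m % 8 = 7) (hn : n = l * m)
    (D : GenusPointData n) (hLs : D.scriptLSpec) (hrec : D.recursion) (heps : D.epsSpec)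
    {αm : APoint D.H} {u : ℤ} (hu : u = 1 ∨ u = -1) (h35m : IsOfFinAddOrder ((2 : ℤ) • D.P m - (u * D.scriptL m) • αm)) :
    (∃ y : APoint D.H, IsOfFinAddOrder (D.P n - (2 : ℤ) • y)) ↔ ∃ y : APoint D.H, IsOfFinAddOrder (D.Z n - (2 : ℤ) • y) :=
  twoDivisible_genusPoint_iff_genusPeriod hl hm hl8 hm8 hn D hrec heps
    (two_dvd_of_isScriptL_prime_one hmod hCM0 hl hl8 (isScriptL_scriptL_left hl hm hn D hLs))
    (odd_scriptL_right h12 hl hm hm8 hn D hLs) hu h35m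

/-- ★★ **THE DEPTH-TWO TRICHOTOMY, parity AND analytic-rank hypotheses on `l` discharged.**  Granted conjuncts 2, 4, 5 of 𝔅_ram, on the two-prime
sector (`l ≡ 1`, `m ≡ 5, 7 (mod 8)`, `n = lm`; data with recursion, `ε`-types, integrality; Thm 3.5 at `m` with `u = ±1`):
if `ord_{s=1} L(E_l,s) = 0` and `#Sel₄(E_l) ≠ 2⁴`: `P(lm) ∈ 4A + tors ⟺ Z(lm) ∈ 4A + tors`;
if `ord_{s=1} L(E_l,s) = 0` and `#Sel₄(E_l) = 2⁴`: `P(lm) ∈ 4A + tors ⟺ Z(lm) − α_m ∈ 4A + tors`;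
if `ord_{s=1} L(E_l,s) ≠ 0` (then `≥ 2`): `P(lm) = Z(lm)`.
[cite: TianYuanZhang2017, §3.1, Thm. 3.5, §1 (1.1)] [cite: BurungaleFlach2024, Thm 1.1 / Cor. 3] [cite: KoblitzECMF1993, Ch. II §5] -/
theorem fourDivisible_genusPoint_trichotomy_of_facts (hmod : WeierstrassCurve.hasEntireLFunction_rat)
    (hCM0 : bsdTriple_of_hasCM_of_L_one_ne_zero) (h12 : thm12_parity_of_scriptL')
    {l m : ℕ} (hl : l.Prime) (hm : m.Prime) (hl8 : l % 8 = 1) (hm8 : m % 8 = 5 ∨ m % 8 = 7) (hn : n = l * m)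
    (D : GenusPointData n) (hLs : D.scriptLSpec) (hrec : D.recursion) (heps : D.epsSpec)
    {αm : APoint D.H} {u : ℤ} (hu : u = 1 ∨ u = -1) (h35m : IsOfFinAddOrder ((2 : ℤ) • D.P m - (u * D.scriptL m) • αm)) :
    ((congruentNumberCurve l).analyticRank = 0 → Nat.card ((congruentNumberCurve l).selmerGroup 4) ≠ 2 ^ 4 →
      ((∃ y : APoint D.H, IsOfFinAddOrder (D.P n - (4 : ℤ) • y)) ↔ ∃ y : APoint D.H, IsOfFinAddOrder (D.Z n - (4 : ℤ) • y))) ∧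
    ((congruentNumberCurve l).analyticRank = 0 → Nat.card ((congruentNumberCurve l).selmerGroup 4) = 2 ^ 4 →
      ((∃ y : APoint D.H, IsOfFinAddOrder (D.P n - (4 : ℤ) • y)) ↔
        ∃ y : APoint D.H, IsOfFinAddOrder (D.Z n - αm - (4 : ℤ) • y))) ∧
    ((congruentNumberCurve l).analyticRank ≠ 0 → D.P n = D.Z n) := by
  have hLm := odd_scriptL_right h12 hl hm hm8 hn D hLs
  refine ⟨fun h0 => (fourDivisible_genusPoint_dichotomy_of_facts hmod hCM0 hl hm hl8 hm8 hn h0 D hLs hrec heps hLm hu h35m).1,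
    fun h0 => (fourDivisible_genusPoint_dichotomy_of_facts hmod hCM0 hl hm hl8 hm8 hn h0 D hLs hrec heps hLm hu h35m).2, fun hne => ?_⟩
  have h2 : 2 ≤ (congruentNumberCurve l).analyticRank := by
    rcases analyticRank_prime_one_eq_zero_or_two_le hl hl8 with h | h
    · exact absurd h hne
    · exact h
  exact genusPoint_eq_genusPeriod_of_two_le_analyticRank hl hm hl8 hm8 hn h2 D hLs hrec heps

/-- ★★★ **C⁺ ON THE INVISIBLE R2 STRATUM, BY NAME: every parity / analytic-rank hypothesis on the prime blocks DISCHARGED.**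
Granted conjuncts 1 (GZK), 2 (modularity), 4 (CM rank-zero BSD), 5 (TYZ Thm 1.2′) of 𝔅_ram; primes `l ≡ 1`, `q ≡ 7 (mod 8)`, `n = lq` with
`ord_{s=1} L(E_n, s) = 1`; display package `D` (`Printed`) with the CM-point layer; `ρ(n) = 0`; the `A_n`-generator of invisible shape
`h = (2s², Y)`; Thm 3.5 at `q` read in `ℍ′_n` (`h35q`, `u = ±1`).  With the DIGIT `δ(l) := [ord_{s=1} L(E_l,s) = 0 ∧ #Sel₄(E_l) = 2⁴]`:
**if `¬δ(l)`: C⁺ at `lq` ⟺ `Z(lq) ∈ 2A + tors ∧ Z(lq) ∉ 4A + tors`;  if `δ(l)`: C⁺ at `lq` ⟺ `Z(lq) ∈ 2A + tors ∧ Z(lq) − α_q ∉ 4A + tors`.**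
(g25's `levelTwo_iff_genusPeriod_depth_dichotomy_of_facts` needed `𝓛(q)` odd and `ord L(E_l) = 0` as hypotheses; here `𝓛(q)` odd is §1 and the
`l`-side is exhausted by §2: rank `0` — the two digit cases — or rank `≥ 2`, where `𝓛(l) = 0` and `P = Z`.)
[cite: TianYuanZhang2017, §3.1, Thm. 3.5, Lemma 3.18, Thm. 1.2, §1 (1.1)] [cite: BurungaleFlach2024, Thm 1.1 / Cor. 3] [cite: Darmon2004, Thm. 3.22]
[cite: KoblitzECMF1993, Ch. II §5, Theorem (p. 84)] [cite: SilvermanAEC2009, Prop. X.1.4, X.4.9] -/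
theorem levelTwo_iff_genusPeriod_depth_of_facts (hGZK : rank_eq_analyticRank_of_analyticRank_le_one)
    (hmod : WeierstrassCurve.hasEntireLFunction_rat) (hCM0 : bsdTriple_of_hasCM_of_L_one_ne_zero) (h12 : thm12_parity_of_scriptL')
    {l q : ℕ} (hl : l.Prime) (hq : q.Prime) (hl8 : l % 8 = 1) (hq8 : q % 8 = 7) (hn : n = l * q)
    (hr : (congruentNumberCurve n).analyticRank = 1)
    (D : GenusPointData n) (hPr : D.Printed) (hC : D.CMPointCompositumPrinted) (hρ : (rhoSubgroup n).index = 1)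
    {X Y : ℚ} (h : (Atwo n).toAffine.Nonsingular X Y) {s : ℚ} (hs : s ≠ 0) (hX : X = 2 * s ^ 2)
    (hgen : ∀ P : (Atwo n).toAffine.Point, ∃ m : ℤ, IsOfFinAddOrder (P - m • (Point.some X Y h : (Atwo n).toAffine.Point)))
    {αq : APoint D.H} {u : ℤ} (hu : u = 1 ∨ u = -1) (h35q : IsOfFinAddOrder ((2 : ℤ) • D.P q - (u * D.scriptL q) • αq)) :
    (¬ ((congruentNumberCurve l).analyticRank = 0 ∧ Nat.card ((congruentNumberCurve l).selmerGroup 4) = 2 ^ 4) →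
      ((∀ L : ℤ, IsScriptL n L → (2 : ℤ) ∣ L ∧ ¬ (4 : ℤ) ∣ L) ↔
        ((∃ y : APoint D.H, IsOfFinAddOrder (D.Z n - (2 : ℤ) • y)) ∧
          ¬ ∃ y : APoint D.H, IsOfFinAddOrder (D.Z n - (4 : ℤ) • y)))) ∧
    (((congruentNumberCurve l).analyticRank = 0 ∧ Nat.card ((congruentNumberCurve l).selmerGroup 4) = 2 ^ 4) →
      ((∀ L : ℤ, IsScriptL n L → (2 : ℤ) ∣ L ∧ ¬ (4 : ℤ) ∣ L) ↔
        ((∃ y : APoint D.H, IsOfFinAddOrder (D.Z n - (2 : ℤ) • y)) ∧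
          ¬ ∃ y : APoint D.H, IsOfFinAddOrder (D.Z n - αq - (4 : ℤ) • y)))) := by
  have hLq : Odd (D.scriptL q) := odd_scriptL_right h12 hl hq (Or.inr hq8) hn D hPr.1
  constructor
  · intro hδ
    rcases analyticRank_prime_one_eq_zero_or_two_le hl hl8 with h0 | h2
    · have hS₄ : Nat.card ((congruentNumberCurve l).selmerGroup 4) ≠ 2 ^ 4 := fun hS => hδ ⟨h0, hS⟩
      exact (levelTwo_iff_genusPeriod_depth_dichotomy_of_facts hGZK hmod hCM0 hl hq hl8 hq8 hn hr h0 D hPr hC hρ h hs hX hgen hLq hu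
        h35q).1 hS₄
    · exact levelTwo_iff_genusPeriod_depth_of_two_le_analyticRank hGZK hl hq hl8 hq8 hn hr h2 D hPr hC hρ h hs hX hgen
  · rintro ⟨h0, hS₄⟩
    exact (levelTwo_iff_genusPeriod_depth_dichotomy_of_facts hGZK hmod hCM0 hl hq hl8 hq8 hn hr h0 D hPr hC hρ h hs hX hgen hLq hu
      h35q).2 hS₄

/-- **The prime `q` of an R2 row has `ord_{s=1} L(E_q, s) = 1` and the prime `l` has `ord_{s=1} L(E_l, s) ∈ {0} ∪ [2, ∞)`** — the analytic
ranks of BOTH proper sub-twists of `n = lq` are decided by name (conjunct 5; Koblitz), so the only analytic-rank HYPOTHESIS left on an R2 row is the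
row's own `ord_{s=1} L(E_{lq}, s) = 1`. [cite: TianYuanZhang2017, Thm. 1.2] [cite: KoblitzECMF1993, Ch. II §5, Theorem (p. 84)] -/
theorem analyticRank_blocks_R2 (h12 : thm12_parity_of_scriptL') {l q : ℕ} (hl : l.Prime) (hq : q.Prime) (hl8 : l % 8 = 1)
    (hq8 : q % 8 = 7) :
    (congruentNumberCurve q).analyticRank = 1 ∧
      ((congruentNumberCurve l).analyticRank = 0 ∨ 2 ≤ (congruentNumberCurve l).analyticRank) :=
  ⟨analyticRank_prime_eq_one h12 hq (Or.inr hq8), analyticRank_prime_one_eq_zero_or_two_le hl hl8⟩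

end TwoPrimes

/-! ## §4 The same with the bundle 𝔅_ram of crux 20509 VERBATIM as hypothesis (conjuncts 1, 2, 4, 5 are used) -/

section Bundle

variable {n : ℕ}

/-- ★★★ **𝔅_ram VERBATIM ⟹ the invisible-R2 reading of C⁺.**  Granted the eleven-fact bundle of crux 20509 (GZK, modularity, Cassels, CM rank-zero
BSD, TYZ 1.2′, Tian 1.3, Rédei–Reichardt, LLT 1.2, Monsky 5.15, Heath-Brown/Monsky even, Tian 𝒮⁻ genus — only conjuncts 1, 2, 4, 5 are used), on an R2
row `n = lq` (`l ≡ 1`, `q ≡ 7 (mod 8)` primes, `ord_{s=1} L(E_n,s) = 1`) with display package `D`, `ρ(n) = 0`, invisible generator `(2s², Y)` and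
Thm 3.5 at `q` in `ℍ′_n`: C⁺ at `lq` ⟺ «`Z(lq)` has depth exactly one», corrected by `α_q` exactly when `ord L(E_l) = 0 ∧ #Sel₄(E_l) = 2⁴`.
[cite: TianYuanZhang2017, §3.1, Thm. 3.5, Thm. 1.2, §1 (1.1)] [cite: BurungaleFlach2024, Thm 1.1 / Cor. 3] [cite: Darmon2004, Thm. 3.22]
[cite: KoblitzECMF1993, Ch. II §5, Theorem (p. 84)] -/
theorem levelTwo_iff_genusPeriod_depth_of_bundle
    (hB : (Literature.NumberTheory.EllipticCurves.rank_eq_analyticRank_of_analyticRank_le_one ∧ WeierstrassCurve.hasEntireLFunction_rat ∧ WeierstrassCurve.bsdRHS_eq_of_isIsogenous ∧ Literature.NumberTheory.EllipticCurves.bsdTriple_of_hasCM_of_L_one_ne_zero ∧ Literature.NumberTheory.EllipticCurves.TianYuanZhang2017.thm12_parity_of_scriptL' ∧ Literature.NumberTheory.EllipticCurves.Tian2014.thm13_rank_one_and_sha_odd ∧ Literature.NumberTheory.QuadraticFields.RedeiReichardt.redeiReichardt_fourTwoCard_classGroup ∧ Literature.NumberTheory.EllipticCurves.LiLiuTian2024.thm12_bsd_congruentNumberCurve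 ∧ Literature.NumberTheory.EllipticCurves.Monsky1990.cor515_rank_eq_one_and_card_selmerGroup_two ∧ Literature.NumberTheory.EllipticCurves.HeathBrown1994.monsky_card_selmerGroup_two_even ∧ Literature.NumberTheory.EllipticCurves.Tian2014.tian2014_system_sMinus_genus))
    {l q : ℕ} (hl : l.Prime) (hq : q.Prime) (hl8 : l % 8 = 1) (hq8 : q % 8 = 7) (hn : n = l * q)
    (hr : (congruentNumberCurve n).analyticRank = 1)
    (D : GenusPointData n) (hPr : D.Printed) (hC : D.CMPointCompositumPrinted) (hρ : (rhoSubgroup n).index = 1)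
    {X Y : ℚ} (h : (Atwo n).toAffine.Nonsingular X Y) {s : ℚ} (hs : s ≠ 0) (hX : X = 2 * s ^ 2)
    (hgen : ∀ P : (Atwo n).toAffine.Point, ∃ m : ℤ, IsOfFinAddOrder (P - m • (Point.some X Y h : (Atwo n).toAffine.Point)))
    {αq : APoint D.H} {u : ℤ} (hu : u = 1 ∨ u = -1) (h35q : IsOfFinAddOrder ((2 : ℤ) • D.P q - (u * D.scriptL q) • αq)) :
    (¬ ((congruentNumberCurve l).analyticRank = 0 ∧ Nat.card ((congruentNumberCurve l).selmerGroup 4) = 2 ^ 4) →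
      ((∀ L : ℤ, IsScriptL n L → (2 : ℤ) ∣ L ∧ ¬ (4 : ℤ) ∣ L) ↔
        ((∃ y : APoint D.H, IsOfFinAddOrder (D.Z n - (2 : ℤ) • y)) ∧
          ¬ ∃ y : APoint D.H, IsOfFinAddOrder (D.Z n - (4 : ℤ) • y)))) ∧
    (((congruentNumberCurve l).analyticRank = 0 ∧ Nat.card ((congruentNumberCurve l).selmerGroup 4) = 2 ^ 4) →
      ((∀ L : ℤ, IsScriptL n L → (2 : ℤ) ∣ L ∧ ¬ (4 : ℤ) ∣ L) ↔
        ((∃ y : APoint D.H, IsOfFinAddOrder (D.Z n - (2 : ℤ) • y)) ∧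
          ¬ ∃ y : APoint D.H, IsOfFinAddOrder (D.Z n - αq - (4 : ℤ) • y)))) :=
  levelTwo_iff_genusPeriod_depth_of_facts hB.1 hB.2.1 hB.2.2.2.1 hB.2.2.2.2.1 hl hq hl8 hq8 hn hr D hPr hC hρ h hs hX hgen hu h35q

/-- **𝔅_ram VERBATIM ⟹ the prime-block digit table** (conjuncts 2, 4, 5): for primes `q ≡ 5, 7 (mod 8)` every `L` with `𝓛(q)² = L²` is odd and
`ord_{s=1} L(E_q,s) = 1`; for primes `l ≡ 1 (mod 8)` every such `L` is even, and `4 ∣ L ⟺ ord_{s=1} L(E_l,s) ≥ 2 ∨ #Sel₄(E_l) ≠ 2⁴`.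
[cite: TianYuanZhang2017, Thm. 1.2, §1 (1.1)] [cite: BurungaleFlach2024, Thm 1.1 / Cor. 3] [cite: KoblitzECMF1993, Ch. II §5, Theorem (p. 84)] -/
theorem primeBlockDigits_of_bundle
    (hB : (Literature.NumberTheory.EllipticCurves.rank_eq_analyticRank_of_analyticRank_le_one ∧ WeierstrassCurve.hasEntireLFunction_rat ∧ WeierstrassCurve.bsdRHS_eq_of_isIsogenous ∧ Literature.NumberTheory.EllipticCurves.bsdTriple_of_hasCM_of_L_one_ne_zero ∧ Literature.NumberTheory.EllipticCurves.TianYuanZhang2017.thm12_parity_of_scriptL' ∧ Literature.NumberTheory.EllipticCurves.Tian2014.thm13_rank_one_and_sha_odd ∧ Literature.NumberTheory.QuadraticFields.RedeiReichardt.redeiReichardt_fourTwoCard_classGroup ∧ Literature.NumberTheory.EllipticCurves.LiLiuTian2024.thm12_bsd_congruentNumberCurve ∧ Literature.NumberTheory.EllipticCurves.Monsky1990.cor515_rank_eq_one_and_card_selmerGroup_two ∧ Literature.NumberTheory.EllipticCurves.HeathBrown1994.monsky_card_selmerGroup_two_even ∧ Literature.NumberTheory.EllipticCurves.Tian2014.tian2014_system_sMinus_genus))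 :
    (∀ q : ℕ, q.Prime → (q % 8 = 5 ∨ q % 8 = 7) →
      (congruentNumberCurve q).analyticRank = 1 ∧ ∀ L : ℤ, IsScriptL q L → Odd L) ∧
    (∀ l : ℕ, l.Prime → l % 8 = 1 → ∀ L : ℤ, IsScriptL l L →
      (2 : ℤ) ∣ L ∧ ((4 : ℤ) ∣ L ↔ 2 ≤ (congruentNumberCurve l).analyticRank ∨ Nat.card ((congruentNumberCurve l).selmerGroup 4) ≠ 2 ^ 4)) :=
  ⟨fun _ hq hq8 => ⟨analyticRank_prime_eq_one hB.2.2.2.2.1 hq hq8, fun _ hL => odd_of_isScriptL_prime hB.2.2.2.2.1 hq hq8 hL⟩,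
    fun _ hl hl8 _ hL => ⟨two_dvd_of_isScriptL_prime_one hB.2.1 hB.2.2.2.1 hl hl8 hL,
      four_dvd_isScriptL_prime_one_iff hB.2.1 hB.2.2.2.1 hl hl8 hL⟩⟩

end Bundle

end Summit.BirchSwinnertonDyer.PrintCf2.PrimeBlockDigits

end
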